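import Mathlib
import HarnessLib

/-!
# Bergeron–Millson–Moeglin 2016, Theorem 7.2 / Corollary 7.3: low-degree cohomological automorphic
# representations of anisotropic unitary groups are `ψ`-theta lifts from smaller unitary groups —
# as a typed dictionary, with the degree-one case proved from it

Reproduction (typed skeleton, DICTIONARY LEVEL — read "Transcription level" below) of: N. Bergeron,
J. Millson, C. Moeglin, *The Hodge conjecture and arithmetic quotients of complex balls*, Acta
Math. **216** (2016), no. 1, 1–125, doi 10.1007/s11511-016-0136-2 [BergeronMillsonMoeglin2016Balls]
(= arXiv:1306.1515): **Theorem 7.2** (p. 65) and **Corollary 7.3** (p. 66), with the setting of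
§§6.1–6.8 (pp. 54–60), Definition 7.1 (p. 64), §7.3 "The global theta lifting" (p. 64) and the
similitude convention §7.5 (p. 65).  NUMBERING: these are the published numbers; the arXiv version
(whose numbering some downstream literature uses) calls them Thm 7.8 / Cor 7.9 / Def 7.5 / §7.4 /
§7.7.  Quotations were read in the open-access published copy (Project Euclid; printed page = PDF
page − 4; page pins below are PRINTED pages of Acta 216, with the PDF page and line of that copy in
brackets where a sentence is pinned) and in the held arXiv text (`paper:arxiv-1306.1515`, where some
user macros `\U`, `\A`, `\C` are dropped by the extraction and restored below from §6.2, §6.8,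
§7.3); the STATEMENTS of Thm 7.2 / Cor 7.3 / Def 7.1 typed here are word-identical in the two
versions.  The SETTING is NOT word-identical: the published text carries two standing hypotheses the
arXiv text (v3, Part 2 §1) does not print — see "PUBLISHED-ONLY STANDING HYPOTHESES" below; the
SETTING paragraph quotes the arXiv wording, as before, with the published page of each sentence.

VERBATIM.  Theorem 7.2, p. 65: "The main automorphic ingredient of our paper is the following
theorem. It is a corollary of Proposition 13.4 below whose proof is the goal of Part 3. Theorem 7.2.
Let `a` and `b` be integers such that `3(a+b)+|a−b| < 2m` and let `π_f ∈ Coh_f^{b,a}`. Set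
`π = A(b×q, a×q) ⊗ π_f`. Then `π` is in the image of the `ψ`-theta correspondence from a smaller
group `U(W)` of signature `(a,b)` at infinity."  Corollary 7.3, p. 66: "Since `Z(𝔸_ℚ^f)` maps into
`T(𝔸_ℚ^f)` via the map `ν`, it acts on the disconnected Shimura variety `S(K)` by permuting the
connected components as described in §6.5. We conclude with the following corollary. Corollary 7.3.
Let `S` be any connected component of `S(K)` and let `a` and `b` be integers such that
`3(a+b)+|a−b| < 2m`. Then `H^{b×q,a×q}(S, ℂ)` is generated by classes of theta lifts from unitary
groups of signature `(a,b)` at infinity."  End of the proof of Thm 7.2 (p. 66 L1–4): "But this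
follows from the explicit description of the Archimedean theta correspondence obtained by Annegret
Paul [61]: the cohomological representation `A(b×q,a×q)` is the image of the local theta
correspondence from a group `U(W, ℂ/ℝ)` with `dim W = a+b` if and only if the signature of `W` is
`(a,b)`." ([61] = A. Paul, J. Funct. Anal. 159 (1998) 384–431 [Paul1998].)

SETTING (verbatim, §§6.1–6.8, pp. 54–60).  §6.1 (p. 54 [PDF 58 L20–40]): "Let `E` be a CM-field
with totally real field maximal subfield `F` with `[F:ℚ] = d`. … Let `V`, `(,)` be a nondegenerate
anisotropic Hermitian vector space over `E` with `dim_E V = m`. … `(p_i,q_i)` is the signature of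
`V_{τ_i}`. We will consider in this paper only those `V`, `(,)` such that `q_2 = … = q_d = 0` and
let `(p,q) = (p_1,q_1)`. By replacing `(,)` by `−(,)` we can, and will, assume that `p ≥ q`."  §6.2
(p. 55 [PDF 59 L13, footnote 5]): "We let `G = Res_{F/ℚ} GU(V)`. [footnote: … in this part of the
paper `G` refers to the unitary *similitude* group and … we now refer to the usual unitary group as
`G_1`.]"  §6.4 (p. 57 [PDF 61 L31–40]): "`S(K) = Sh_K(G,X)(ℂ) = G(ℚ)\(X × G(𝔸_ℚ^f))/K`. We will
always choose `K` to be *neat* … In general `S(K)` is not connected; this is a disjoint union of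
spaces of the type `S(Γ)`".  §6.6 (p. 59 [PDF 63 L24–31]): "Since `G` is anisotropic each
`L²(G, ω)` decomposes as a direct sum of irreducible unitary representations of `G(𝔸)` with finite
multiplicities. A representation `π` which occurs in this way is called an *automorphic
representation* of `G` … We shall write `π = π_∞ ⊗ π_f` … and by `m(π)` its multiplicity in
`L²(G, ω)`."  §6.7 (pp. 59–60; the sentence on `Coh_∞` p. 59 [PDF 63 L32–33], the trivial
central character sentence and the three displayed definitions `Inf(π_f)`, `Coh_f`, `Coh_f^{b,a}`
p. 60 [PDF 64 L6–14]): "Let `Coh_∞` be the set of unitary representations `π_∞` of `G(ℝ)` (up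
to equivalence) such that `H•(𝔤, K_∞; π_∞) ≠ 0` …
Since we only consider cohomological representations of `G(ℝ)` having trivial central character
the classification of `Coh_∞` amounts to the Vogan-Zuckerman classification. … For any `π_f`, set
`Inf(π_f) = {π_∞ ∈ Coh_∞ : m(π_∞ ⊗ π_f) ≠ 0}`. Let `Coh_f` be the set of `π_f` such that `Inf(π_f)`
is non-empty. We will be particularly interested in the cohomological representations
`A(b×q, a×q)`; we denote by `Coh_f^{b,a}` the set of `π_f` such that `Inf(π_f)` contains
`A(b×q, a×q)`."  §6.8 (p. 60 [PDF 64 L33]): "Given two integers `a` and `b` we denote by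
`H^{b×q,a×q}(S(K), ℂ)` the part of `H•(S(K), ℂ)` which corresponds to the cohomological
representation `π_∞ = A(b×q, a×q)`".

PUBLISHED-ONLY STANDING HYPOTHESES (Acta 216 text; ABSENT from the arXiv v3 wording of the same
paragraphs, `paper:arxiv-1306.1515` chunk p0029 L10–14, which is the wording quoted in SETTING
above).  §1.1, p. 1 [PDF 1 L24–26]: "We shall always assume that the Hermitian space `(V, (·,·))`
is anisotropic, of signature `(p,q)`, with `p, q > 0`, at one Archimedean place and positive
definite at all other infinite places. Note that if `p+q > 2` this forces `F ≠ ℚ`."  §6.1, p. 54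
[PDF 58 L20–21], immediately after "`[F:ℚ] = d`": "We assume that `d > 1`."  So, AS PUBLISHED,
Theorem 7.2 and Corollary 7.3 are stated under `d = [F:ℚ] ≥ 2` and `q ≥ 1` (with `p ≥ q`, i.e.
`m = p + q ≥ 2`), in addition to anisotropy, `q_2 = … = q_d = 0` and `K` neat.  These are parameters
of the intended meaning of the dictionary `BMMSpectrum` below (not fields), recorded in its
docstring and in those of `Thm_7_2` / `Cor_7_3`; for `m ≥ 3` anisotropy of an indefinite `V` already
forces `d ≥ 2` (GENERALITY below), so no typed statement changes.

THETA SIDE, §7.3 (p. 64 [PDF 68 L5–21]): "We denote by `𝒜^c(U(W))` the set of irreducible cuspidal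
automorphic representations of `U_n(𝔸)` … `θ^f_{ψ,χ,φ}(g) = ∫_{[U_n]} θ_{ψ,χ,φ}(g,g') f(g') dg'` …
We denote by `Θ_{ψ,χ,W}^V(π')` the space of the automorphic representation generated by all
`θ^f_{ψ,χ,φ}(g)` as `φ` and `f` vary, and call `Θ_{ψ,χ,W}^V(π')` the `(ψ,χ)`-theta lifting of `π'`
to `U_m(𝔸)`."  Definition 7.1 (p. 64 [PDF 68 L27–30]): "We say that a representation
`π ∈ 𝒜^c(U(V))` *is in the image of the cuspidal `ψ`-theta correspondence from a smaller group* if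
there exists a skew-Hermitian space `W` with `dim W ≤ m`, a representation `π' ∈ 𝒜^c(U(W))` and a
pair of characters `χ` such that `π = Θ_{ψ,χ,W}^V(π')`."  §7.5 (p. 65 [PDF 69 L42–45]): "an
automorphic representation `π` of `G` is in the image of the extension to unitary similitude
groups of the theta correspondence from a smaller group `GU(W)` if `π_1` is in the image of the
`ψ`-theta correspondence from `U(W)`.  In that case we will loosely say that `π` is in the image of
the `ψ`-theta correspondence from `U(W)`."  Theorem 7.2 itself: p. 65 [PDF 69 L46–51]; Corollary
7.3: p. 66 [PDF 70 L6–13].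

STATUS OF THE SOURCE (printed, quoted, not interpreted).  The arXiv version, §1.9: "Thus, as
pointed out in the abstract, our work is still conditional on extensions to the twisted case of
results which have only been proved so far in the case of connected groups. This is now announced
by Waldspurger and Moeglin-Waldspurger see [WaldsSeoul]."  That sentence does NOT occur in the
published paper, whose §1.4 "General strategy of proof", pp. 8–9, reads: "This relies on Arthur's
recent endoscopic classification of automorphic representations of classical groups. Arthur's
theory relates the classification of `G` to the classification of the non-connected group
`GL(N) ⋊ ⟨θ⟩` (where `θ` is some automorphism of `GL(N)`) through the stabilization of the
twisted trace formula recently obtained by Moeglin and Waldspurger [58]. This is the subject of §12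
and §13."; §12.5 "Weak base change", p. 94: "The following proposition is essentially due to Arthur
[3, Corollary 3.4.3] though it is not stated for unitary groups; see [59, Corollary 4.3.8] for a
statement in the latter case when `G` is quasi-split. The reduction from the general case to the
quasi-split case follows the same lines;(13) we provide some details in Appendix A. (When Kaletha,
Minguez, Shin and White have finished their three announced papers, this will be included.)" with
footnote (13) "The use of the stable twisted trace formula being replaced by the (untwisted) stable
trace formula." ([3] = Arthur's book, [59] = Mok); Appendix A.2 "The general (non-quasi-split)
case", Theorem A.4, pp. 109–110.

STATUS IN LATER PRINT (quoted, not interpreted; as of 2026-08).  The announced work the §12.5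
parenthetical refers to is Kaletha–Minguez–Shin–White, arXiv:1409.3731 (2014; zbMATH "Preprint",
2026-08).  Refereed print on its status: [GerbelliGauthier2023] §1.2 "Conditionality": "Our results
are conditional on the endoscopic classification of representations for inner forms of unitary
groups, a result which remains to be fully proved in two distinct ways. As explained in the
introduction of [KMSW], the classification depends on upcoming work of Chaudouard-Laumon on the
weighted fundamental lemma. Moreover, the proof of the classification in [KMSW] is not itself
complete: in particular, the results appearing here as Theorem (local character identities …) and
Theorem (Rdisc computes the traces on the packet) are only proved for generic parameters. A full
proof is expected in [KMS]." ([KMS] = Kaletha–Minguez–Shin, "Endoscopic classification of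
representations: Non-tempered representations of inner forms of unitary groups", listed there
without venue or year).  On the QUASI-SPLIT prerequisite ([3] Arthur, [59] Mok):
[AtobeGanIchinoKalethaMinguezShin2024] Introduction: "The goal of this paper is to prove all unproven
assertions that [Ar] and [Mok] rely on, apart from the twisted weighted fundamental lemma,
uniformly for quasi-split symplectic, special orthogonal, and unitary groups. … As a consequence of
this paper, the main endoscopic classification for quasi-split classical groups will become
unconditional as soon as the twisted weighted fundamental lemma is fully verified."; [Taibi2025LLC]:
"For completeness we recall that to our knowledge the main results of [Arthur_book] and
[Mok_unitary] still depend on unpublished results."  For `m = 3` (the complex 2-ball) the endoscopic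
classification of `U(3)` AND of its inner forms is Rogawski's, Ann. of Math. Stud. 123 (1990) with
the 1992 multiplicity formula (`Literature/NumberTheory/Rogawski1990/`) — [MartinWakatsuki2024] p. 4:
"For n=3, the endoscopic classification was completed for all inner forms in [rogawski], and thus
our results are unconditional at least for n=3." — but the paper reproduced HERE does not route its
`m = 3` case through Rogawski (its Rogawski citations concern special cycles, [GRS1–3], and
`H^{1,1}`, Blasius–Rogawski); reading Thm 7.2 at `m = 3` as unconditional is a substitution the
source does not print.  A theta-theoretic Arthur multiplicity formula for (not necessarily
quasi-split) unitary groups, assuming it for quasi-split ones, is [ChenZou2025AMF].  None of this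
changes the class of any predicate below: Thm 7.2 / Cor 7.3 are quoted as PUBLISHED theorems.

GENERALITY.  `V` anisotropic of signature `(p,q)` at one real place and definite at the others,
`m = p + q`; e.g. a hermitian 3-space over a CM field of signature `(2,1)` at one real place of `F`
and definite at the `d − 1 ≥ 1` others (`m = 3`, arithmetic quotients of the complex 2-ball,
`d ≥ 2`).  NOT covered: the non-compact case `d = 1` (an indefinite hermitian space of dimension
`≥ 3` over an imaginary quadratic field is isotropic; and the published text EXCLUDES `d = 1`
outright: §6.1 p. 54 "We assume that `d > 1`", §1.1 p. 1 "Note that if `p+q > 2` this forces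
`F ≠ ℚ`"), where Rogawski's book and Gelbart–Rogawski apply instead
(`Literature/NumberTheory/GelbartRogawski1991/`); nor `q = 0` (published §1.1 p. 1 "with
`p, q > 0`").

## Transcription level

Mathlib has no automorphic representations, Shimura varieties or theta correspondence.  The
objects the printed statements quantify over are POSITED as the fields of ONE dictionary
`BMMSpectrum` (types, functions and the `ℂ`-module instances of the posited cohomology groups; no
propositional field), and every printed statement is a predicate `def … (X : BMMSpectrum) : Prop`
whose docstring starts with its class: **P** = VERBATIM quotation with locator (`CohF` §6.7,
`InThetaImageFrom` Def 7.1 + §7.5 + Thm 7.2's wording, `degreeBound`, `Thm_7_2`, `Cor_7_3`);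
**K** = proved here from P-statements by elementary logic/arithmetic (`degreeBound_of_add_eq_one`,
`thm_7_2_degree_one`, `thm_7_2_from_line`, `cor_7_3_degree_one`: the case `a + b = 1`, `m ≥ 3` —
all of `H^{1×q, 0×q}` and `H^{0×q, 1×q}` comes from `1`-dimensional `W`, i.e. from `U(1)`; for
`m = n ≥ 3`, `q = 1`, `a + b = 1` this is the instance "[BMM, Proposition 13.4] (with `m=n`,
`p=n−1`, `q=1`, `a+b=1`)" invoked by Liu, Cambridge J. Math. 9 (2021), proof of Prop. 4.13
[Liu2021]).  NOTHING IS ASSERTED: a consumer supplies the dictionary from its own model (for ONE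
`(E/F, V, ψ, K)`) and takes `(h : X.Thm_7_2)` as an explicit hypothesis — never
`∀ X : BMMSpectrum, X.Thm_7_2`, which is junk-false.

NOT here: the theta correspondence, the Shimura variety, Part 3 (Prop 13.4) and Arthur's
classification, the Hodge-type bookkeeping `H^{b×q,a×q} ↔ A(b×q,a×q)` of §1.7(2) beyond the posited
field `Hba`.

## References

* N. Bergeron, J. Millson, C. Moeglin, Acta Math. 216 (2016) 1–125, Thm 7.2 p. 65, Cor 7.3 p. 66,
  §1.1 p. 1, §1.4 pp. 8–9, §§6–7 pp. 54–66, §12.5 p. 94, App. A pp. 103–110 (= arXiv:1306.1515,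
  Thm 7.8 / Cor 7.9).
  [BergeronMillsonMoeglin2016Balls]
* A. Paul, J. Funct. Anal. 159 (1998) 384–431 (= BMM [61]). [Paul1998]
* Y. Liu, Cambridge J. Math. 9 (2021), Prop 4.13 (a published use of the degree-one instance).
  [Liu2021]
* Status sources (§ "STATUS IN LATER PRINT"): M. Gerbelli-Gauthier, Algebra Number Theory 17 (2023)
  2181–2228, §1.2 (= arXiv:2105.09834) [GerbelliGauthier2023]; H. Atobe, W. T. Gan, A. Ichino,
  T. Kaletha, A. Mínguez, S. W. Shin, arXiv:2410.13504 (2024), Introduction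
  [AtobeGanIchinoKalethaMinguezShin2024]; O. Taïbi, arXiv:2510.00632 (2025), survey [Taibi2025LLC];
  K. Martin, S. Wakatsuki, J. Number Theory 257 (2024) 249–272, p. 4 (= arXiv:1907.03417)
  [MartinWakatsuki2024]; R. Chen, J. Zou, J. Eur. Math. Soc. 27 (2025) (= arXiv:2103.07956)
  [ChenZou2025AMF].
-/

noncomputable section

namespace Literature.RepresentationTheory.BergeronMillsonMoeglin2016

universe u

/-- **Posited primitives** for [BergeronMillsonMoeglin2016Balls] §§6–7 (see the module docstring
for the verbatim setting).  Parameters of the intended meaning that do not appear as fields: the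
CM extension `E/F`, `d = [F:ℚ]` with `d ≥ 2` (published §6.1 p. 54: "We assume that `d > 1`"),
the anisotropic Hermitian space `V` of signature `(p,q)` at `τ_1` with `p ≥ q ≥ 1` (published §1.1
p. 1: "with `p, q > 0`"), definite at `τ_2, …, τ_d`, `p + q = m`, the additive character `ψ`, the
neat level `K`.
Fields:
* `m` — `dim_E V`;
* `RepF` — representations `π_f` of `G(𝔸_ℚ^f)`, `G = Res_{F/ℚ} GU(V)` (§6.6);
* `CohInf` — the finite set `Coh_∞` of cohomological unitary representations `π_∞` of `G(ℝ)` with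
  trivial central character (§6.7); `A b a` — its element `A(b×q, a×q)` (§3 and §6.7; total in
  `a b : ℕ`, meaningful in the printed range of the Young diagrams `b×q`, `a×q`);
* `mult π_∞ π_f` — the multiplicity `m(π_∞ ⊗ π_f)` in `L²(G, ω̃)` (§6.6), so that
  `Inf(π_f) = {π_∞ | mult π_∞ π_f ≠ 0}`;
* `SkewHerm` — isomorphism classes of nondegenerate skew-Hermitian spaces `W` over `E` (§7.1; "We
  will sometimes abusively refer to `W` as a Hermitian space", Remark after §7.1);
  `sigInf W = (a,b)` — the signature of `W` "at infinity", i.e. at the real place under `τ_1`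
  (Thm 7.2: "a smaller group `U(W)` of signature `(a,b)` at infinity"), so that `dim_E W = a + b`
  (`dimW`);
* `IsThetaLiftFrom π_∞ π_f W` — "`π = π_∞ ⊗ π_f` is in the image of the `ψ`-theta correspondence
  from `U(W)`" in the sense of Def 7.1 + §7.5: there exist `π' ∈ 𝒜^c(U(W))` and a pair of
  characters `χ` with `π_1 = Θ^V_{ψ,χ,W}(π')`, `π_1` the restriction of `π` to `G_1 = Res_{F/ℚ} U(V)`;
* `Comp` — the connected components `S` of `S(K)` (§6.4–6.5); `Coh S` — the complex vector space
  `H•(S, ℂ)`; `Hba S b a` — its subspace `H^{b×q, a×q}(S, ℂ)` (§6.8, on the component `S`);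
  `thetaClasses S a b` — the "classes of theta lifts from unitary groups of signature `(a,b)` at
  infinity" on `S` (Cor 7.3), i.e. the classes of the forms `θ^f_{ψ,χ,φ}` (§7.3) for `W` with
  `sigInf W = (a,b)`.
[cite: BergeronMillsonMoeglin2016Balls, §§6.1–6.8 pp. 54–60, §7.1–7.5 pp. 62–65] -/
structure BMMSpectrum : Type (u + 1) where
  /-- `m = dim_E V` -/
  m : ℕ
  /-- representations `π_f` of `G(𝔸_ℚ^f)` -/
  RepF : Type u
  /-- `Coh_∞` -/
  CohInf : Type u
  /-- `m(π_∞ ⊗ π_f)` -/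
  mult : CohInf → RepF → ℕ
  /-- `A b a = A(b×q, a×q)` -/
  A : ℕ → ℕ → CohInf
  /-- skew-Hermitian spaces `W` over `E` -/
  SkewHerm : Type u
  /-- signature `(a,b)` of `W` at infinity -/
  sigInf : SkewHerm → ℕ × ℕ
  /-- `π_∞ ⊗ π_f` is in the image of the `ψ`-theta correspondence from `U(W)` (Def 7.1 + §7.5) -/
  IsThetaLiftFrom : CohInf → RepF → SkewHerm → Prop
  /-- connected components `S` of `S(K)` -/
  Comp : Type u
  /-- `H•(S, ℂ)` -/
  Coh : Comp → Type u
  [instAddCommGroup : ∀ S, AddCommGroup (Coh S)]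
  [instModule : ∀ S, Module ℂ (Coh S)]
  /-- `H^{b×q, a×q}(S, ℂ) ⊆ H•(S, ℂ)` -/
  Hba : (S : Comp) → ℕ → ℕ → Submodule ℂ (Coh S)
  /-- classes on `S` of theta lifts from `U(W)`, `W` of signature `(a,b)` at infinity -/
  thetaClasses : (S : Comp) → ℕ → ℕ → Set (Coh S)

attribute [instance] BMMSpectrum.instAddCommGroup BMMSpectrum.instModule

namespace BMMSpectrum

variable (X : BMMSpectrum.{u})

/-- P (definition, §6.7, pp. 59–60; the displayed definitions are on p. 60 [PDF 64 L9–14]). "For any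
`π_f`, set `Inf(π_f) = {π_∞ ∈ Coh_∞ : m(π_∞ ⊗ π_f) ≠ 0}`. … we denote by `Coh_f^{b,a}` the set of `π_f`
such that `Inf(π_f)` contains `A(b×q, a×q)`."  So `π_f ∈ Coh_f^{b,a} ⟺ m(A(b×q, a×q) ⊗ π_f) ≠ 0`.
[cite: BergeronMillsonMoeglin2016Balls, §6.7 p. 60] -/
def CohF (b a : ℕ) : Set X.RepF := {πf | X.mult (X.A b a) πf ≠ 0}

/-- Unfolding of `CohF`. [cite: BergeronMillsonMoeglin2016Balls, §6.7 p. 60] -/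
theorem mem_cohF_iff {b a : ℕ} {πf : X.RepF} : πf ∈ X.CohF b a ↔ X.mult (X.A b a) πf ≠ 0 :=
  Iff.rfl

/-- `dim_E W = a + b` for `W` of signature `(a,b)` at infinity (definitional for a nondegenerate
form). [folklore] -/
def dimW (W : X.SkewHerm) : ℕ := (X.sigInf W).1 + (X.sigInf W).2

/-- P (the conclusion of Thm 7.2 as a predicate, with Def 7.1 and §7.5): "`π` is in the image of
the `ψ`-theta correspondence from a smaller group `U(W)` of signature `(a,b)` at infinity" — there
EXISTS a skew-Hermitian `W` over `E` of signature `(a,b)` at infinity from whose unitary group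
`π = π_∞ ⊗ π_f` is a `ψ`-theta lift.
[cite: BergeronMillsonMoeglin2016Balls, Def 7.1 p. 64, §7.5 p. 65, Thm 7.2 p. 65] -/
def InThetaImageFrom (πinf : X.CohInf) (πf : X.RepF) (a b : ℕ) : Prop :=
  ∃ W : X.SkewHerm, X.sigInf W = (a, b) ∧ X.IsThetaLiftFrom πinf πf W

/-- P (the printed hypothesis of Thm 7.2 / Cor 7.3): "Let `a` and `b` be integers such that
`3(a+b)+|a−b| < 2m`" (stated in `ℤ`; `a, b ≥ 0` index the Young diagrams `a×q`, `b×q`).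
[cite: BergeronMillsonMoeglin2016Balls, Thm 7.2 p. 65] -/
def degreeBound (a b : ℕ) : Prop := 3 * ((a : ℤ) + b) + |(a : ℤ) - b| < 2 * (X.m : ℤ)

/-- P. **Theorem 7.2** (arXiv: Thm 7.8): "Let `a` and `b` be integers such that
`3(a+b)+|a−b| < 2m` and let `π_f ∈ Coh_f^{b,a}`. Set `π = A(b×q, a×q) ⊗ π_f`. Then `π` is in the
image of the `ψ`-theta correspondence from a smaller group `U(W)` of signature `(a,b)` at
infinity."  Printed proof (pp. 65–66): "It is a corollary of Proposition 13.4 below whose proof is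
the goal of Part 3. … The only remaining thing to be proved is that the signature at infinity is
`(a,b)` … this follows from the explicit description of the Archimedean theta correspondence
obtained by Annegret Paul [61]".  Setting: module docstring (SETTING, PUBLISHED-ONLY STANDING
HYPOTHESES).
HYPOTHESES OF RECORD (parameters of the intended meaning of `X`, not fields; all printed): `E/F` CM
with `d = [F:ℚ] ≥ 2` (§6.1 p. 54 "We assume that `d > 1`"); `V` anisotropic of signature `(p,q)`
at `τ_1` with `p ≥ q ≥ 1` and positive definite at `τ_2, …, τ_d` (§1.1 p. 1, §6.1 p. 54),
`m = p + q`; `G = Res_{F/ℚ} GU(V)` (§6.2 p. 55); `K` neat (§6.4 p. 57); `Coh_∞` = cohomological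
representations with TRIVIAL central character, i.e. trivial coefficients (§6.7 p. 60); `a, b ≥ 0`
with `3(a+b)+|a−b| < 2m` (the displayed hypothesis, `degreeBound`).
STATUS OF THE PRINTED PROOF (quoted in full in the module docstring, § STATUS OF THE SOURCE /
STATUS IN LATER PRINT; recorded here so that a consumer of `(h : X.Thm_7_2)` sees it at the point
of use): the proof is "Proposition 13.4 below whose proof is the goal of Part 3" (p. 65), and Part 3
"relies on Arthur's recent endoscopic classification of automorphic representations of classical
groups … through the stabilization of the twisted trace formula recently obtained by Moeglin and
Waldspurger [58]" (§1.4 pp. 8–9; [3] = Arthur, [59] = Mok for quasi-split unitary groups); for the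
NON-quasi-split `G` of this paper the reduction to the quasi-split case is §12.5 p. 94 with
footnote (13) and Appendix A.2, Theorem A.4 pp. 109–110, printed with the parenthesis "(When
Kaletha, Minguez, Shin and White have finished their three announced papers, this will be
included.)"; the arXiv v3 §1.9 wording is "our work is still conditional on extensions to the
twisted case of results which have only been proved so far in the case of connected groups".  The
predicate is quoted as a PUBLISHED theorem; whoever discharges or assumes it inherits exactly this
printed dependence — nothing here adjudicates it.
[cite: BergeronMillsonMoeglin2016Balls, Theorem 7.2, p. 65] -/
def Thm_7_2 (X : BMMSpectrum.{u}) : Prop :=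
  ∀ (a b : ℕ) (πf : X.RepF), X.degreeBound a b → πf ∈ X.CohF b a →
    X.InThetaImageFrom (X.A b a) πf a b

/-- P. **Corollary 7.3** (arXiv: Cor 7.9): "Let `S` be any connected component of `S(K)` and let
`a` and `b` be integers such that `3(a+b)+|a−b| < 2m`. Then `H^{b×q, a×q}(S, ℂ)` is generated by
classes of theta lifts from unitary groups of signature `(a,b)` at infinity."  TYPED AS the
containment `H^{b×q,a×q}(S, ℂ) ≤ span_ℂ (those classes)`, which is what "is generated by" asserts
about `H^{b×q,a×q}(S, ℂ)`; the converse containment (the theta classes of signature `(a,b)` lie in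
that summand) is not typed.  HYPOTHESES OF RECORD and STATUS OF THE PRINTED PROOF: as for `Thm_7_2`
(same standing hypotheses `d ≥ 2`, `p ≥ q ≥ 1`, `V` anisotropic, `K` neat, trivial coefficients;
the corollary is drawn in print from Theorem 7.2, p. 66 [PDF 70 L6–10], so it carries the same
printed dependence on Arthur's endoscopic classification via Proposition 13.4 / Part 3, §1.4
pp. 8–9, §12.5 p. 94, Appendix A.2 Thm A.4).
[cite: BergeronMillsonMoeglin2016Balls, Corollary 7.3, p. 66] -/
def Cor_7_3 (X : BMMSpectrum.{u}) : Prop :=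
  ∀ (S : X.Comp) (a b : ℕ), X.degreeBound a b →
    X.Hba S b a ≤ Submodule.span ℂ (X.thetaClasses S a b)

/-! ### Proved: the degree-one case (`a + b = 1`), i.e. `H^{1×q,0×q} ⊕ H^{0×q,1×q}` — for `q = 1`,
`H^{1,0} ⊕ H^{0,1}` -/

/-- K (arithmetic). For `a + b = 1` the printed bound `3(a+b)+|a−b| < 2m` reads `4 < 2m`, i.e.
`m ≥ 3`. [cite: BergeronMillsonMoeglin2016Balls, Thm 7.2, p. 65] -/
theorem degreeBound_iff_of_add_eq_one {a b : ℕ} (hab : a + b = 1) :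
    X.degreeBound a b ↔ 3 ≤ X.m := by
  unfold degreeBound
  rcases Nat.eq_zero_or_pos a with ha | ha
  · subst ha
    have hb : b = 1 := by omega
    subst hb
    norm_num
    omega
  · have hb : b = 0 := by omega
    have ha1 : a = 1 := by omega
    subst hb ha1
    norm_num
    omega

/-- K. The bound holds in degree one as soon as `m ≥ 3`.
[cite: BergeronMillsonMoeglin2016Balls, Thm 7.2, p. 65] -/
theorem degreeBound_of_add_eq_one {a b : ℕ} (hab : a + b = 1) (hm : 3 ≤ X.m) :
    X.degreeBound a b :=
  (X.degreeBound_iff_of_add_eq_one hab).2 hm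

/-- K. Thm 7.2 in degree one, `m ≥ 3`: every `π_f` contributing to `H^{1×q, 0×q}`
(`π_f ∈ Coh_f^{1,0}`) is, with `π_∞ = A(1×q, 0×q)`, a `ψ`-theta lift from a `U(W)` of signature
`(0,1)` at infinity, and every `π_f ∈ Coh_f^{0,1}` one from signature `(1,0)`; in both cases
`dim_E W = 1` (`thm_7_2_from_line`).  Which of the two summands is "`H^{1,0}`" for `q = 1` is the
Hodge-type convention of §6.8 / §1.7(2) (`H^{b×q,a×q} ↔ A(b×q,a×q)`), not decided here.
[cite: BergeronMillsonMoeglin2016Balls, Theorem 7.2, p. 65] -/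
theorem thm_7_2_degree_one (h : X.Thm_7_2) (hm : 3 ≤ X.m) :
    (∀ πf ∈ X.CohF 1 0, X.InThetaImageFrom (X.A 1 0) πf 0 1) ∧
    (∀ πf ∈ X.CohF 0 1, X.InThetaImageFrom (X.A 0 1) πf 1 0) :=
  ⟨fun πf hπ => h 0 1 πf (X.degreeBound_of_add_eq_one (by norm_num) hm) hπ,
   fun πf hπ => h 1 0 πf (X.degreeBound_of_add_eq_one (by norm_num) hm) hπ⟩

/-- K. Same, stated with the dimension: the lifting group is the unitary group of a LINE
(`dim_E W = 1`). [cite: BergeronMillsonMoeglin2016Balls, Theorem 7.2, p. 65] -/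
theorem thm_7_2_from_line (h : X.Thm_7_2) (hm : 3 ≤ X.m) {a b : ℕ} (hab : a + b = 1)
    {πf : X.RepF} (hπ : πf ∈ X.CohF b a) :
    ∃ W : X.SkewHerm, X.dimW W = 1 ∧ X.IsThetaLiftFrom (X.A b a) πf W := by
  obtain ⟨W, hsig, hW⟩ := h a b πf (X.degreeBound_of_add_eq_one hab hm) hπ
  refine ⟨W, ?_, hW⟩
  simp only [dimW, hsig]
  exact hab

/-- K. Cor 7.3 in degree one, `m ≥ 3`: on every connected component `S` of `S(K)`,
`H^{1×q,0×q}(S, ℂ)` is contained in the span of the classes of theta lifts from unitary groups of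
signature `(0,1)` at infinity, and `H^{0×q,1×q}(S, ℂ)` in the span of those of signature `(1,0)`.
[cite: BergeronMillsonMoeglin2016Balls, Corollary 7.3, p. 66] -/
theorem cor_7_3_degree_one (h : X.Cor_7_3) (hm : 3 ≤ X.m) (S : X.Comp) :
    X.Hba S 1 0 ≤ Submodule.span ℂ (X.thetaClasses S 0 1) ∧
    X.Hba S 0 1 ≤ Submodule.span ℂ (X.thetaClasses S 1 0) :=
  ⟨h S 0 1 (X.degreeBound_of_add_eq_one (by norm_num) hm),
   h S 1 0 (X.degreeBound_of_add_eq_one (by norm_num) hm)⟩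

/-- K (sanity of the bound in the other direction): for `m ≤ 2` the printed hypothesis is never
satisfied when `a + b ≥ 1`, so Thm 7.2 / Cor 7.3 say nothing about curves (`m = 2`).
[cite: BergeronMillsonMoeglin2016Balls, Thm 7.2, p. 65] -/
theorem not_degreeBound_of_le_two (hm : X.m ≤ 2) (a b : ℕ) (hab : 1 ≤ a + b) :
    ¬ X.degreeBound a b := by
  unfold degreeBound
  have h1 : (a : ℤ) - b ≤ |(a : ℤ) - b| := le_abs_self _
  have h2 : -((a : ℤ) - b) ≤ |(a : ℤ) - b| := neg_le_abs _
  omega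

end BMMSpectrum

end Literature.RepresentationTheory.BergeronMillsonMoeglin2016

end
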